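import Summits.Ventures.HSemireg.FlatMenuFrameLemma

/-!
# Venture HSemireg — the FRAME LEMMA and LEMMA (M) of the g = 8 family-A flat-menu census, INSTANCES: the integral flat menu
# (`R = ℤ`, row A17-J9: every Plücker entry ∈ {0, ±1}, support ≤ 4 ⟺ θ-degree ≤ 8, multiplicity `n_W · #supp ≤ 4`) and the CM
# anchor `E_i⁴` (`R = ℤ[i]`, rows A17-J10 ∕ J11: entry norms ∈ {0, 1, 2}, `|P|² ≤ c`, `n_W · |P|² ≤ c`; c = 4, and c = 16 for E₈)

HONEST FRAMING. Part of the Lean index of the computation cell `pub-hsemireg` (Sunday typer seat p9, § g = 8; census rows **A17-J9,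
A17-J10, A17-J11** of `target-g8/CENSUS.md` v1.274 `7744dc4867915f69`, family A, n = 4, door (4) «hunt representatives», all three
«NOT-AN-OBJECT (menu empty)»). This file SPECIALISES the abstract statements of `FlatMenuFrameLemma.lean` (see its module docstring for
the TEXTS OF RECORD: t-17 g7 `target-g8/FAMILY-A-G8-t17-g7.md` v1.7 `30f228fa15a40313` §4.7.5 FRAME LEMMA, §4.7.6 LEMMA (M), §4.9 (5);
hand ×2 th-1 g39 INBOX l.7245 ∕ l.7642) to the two coefficient rings the census uses: `ℤ` with the trivial star and `N x = x·x` (the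
integral planes of E⁴, E any elliptic curve) and the Gaussian integers `GaussianInt = ℤ[i]` with `star` = conjugation and `N =
Zsqrtd.norm` (the anchor E_i⁴, End = ℤ[i]). The Eisenstein anchor E_ω⁴ is NOT instantiated (no bundled star-ring `ℤ[ω]` in Mathlib;
the abstract file applies verbatim). Integer arithmetic only; no variety, subsurface, class or sheaf is constructed; the dictionary
(«δ_W = 2·|P(W)|²», «#supp P = |P|²» for {0,±1}-vectors, class equation ⟺ frame identity) is TEXT OF RECORD there, not a binder
here; the machine censuses stay machine; nothing here says that HC ∕ HC_CM ∕ HC_AV holds; no object is certified; no Literature fact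
is declared.

TEXTS OF RECORD specialised here (quoted). §4.7.5: «In every class solution every member has all P_ab(W_j) ∈ {0, ±1}; hence δ_{W_j}
= 2·#supp P(W_j)». §4.7.6: «(i) EVERY MEMBER OF EVERY CLASS SOLUTION HAS θ-DEGREE δ_W ≤ 8 — on E⁴ for every E and at the CM anchors
alike, integral or not; (ii) n_W·δ_W ≤ 8: members of degree 8 or 6 are simple, a member of degree 4 occurs at most twice, a
coordinate plane (degree 2) at most four times … CONSEQUENCES. (a) … a member of an integral class solution has P ∈ {0, ±1}⁶ (§4.7.5)
and #supp P = |P|² ≤ 4, so it is one of the 74 planes of degree ≤ 8». §4.9 (5): «every member of a class solution has all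
N(P_ab(W_j)) ≤ 3: P_ab ∈ {0} ∪ O_K^× ∪ (1+i)·O_K^× for ℤ[i] (norms 0, 1, 2)». th-1 l.7642 (ii): «|P|² = 4, 3 ⇒ n_W ≤ 1; |P|² = 2 ⇒
n_W ≤ 2; |P|² = 1 ⇒ n_W ≤ 4 ✓ (your multcheck maxima {8:1, 6:1, 4:2, 2:4} are the bounds, attained)».

WHAT THIS FILE PROVES (kernel). §4 `R = ℤ`: `int_isFrame_iff` (the identity reads `Σ_j P_j(a)P_j(b) = c·δ_ab`), `int_mul_self_lt`
(any c ≠ 1: x² < c for every entry), **`int_natAbs_le_one`** ∕ `int_mem_of_frame` (c = 4: every entry of every primitive member ∈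
{0, ±1}), `int_normSq_eq_card_support` (|v|² = #supp for such vectors), `int_card_copies_mul_normSq_le` (any c: n_W·|P|² ≤ c and
|P|² ≤ c), **`int_card_support_le_four`** (c = 4: #supp ≤ 4, i.e. δ ≤ 8), `int_card_copies_mul_support_le_four` (n_W·#supp ≤ 4),
`int_member_shape` (assembled), and the NON-VACUITY ∕ SHARPNESS witness `coordinateDesign_isFrame_and_sharp` (four copies of each
coordinate vector: a primitive integral tight frame with c = 4 attaining n_W·#supp = 4). §5 `R = ℤ[i]`: **`gaussInt_norm_le_two`**
(c = 4: entry norms ≤ 2; norm 3 does not occur in ℤ[i]; `gaussInt_norm_lt` for any c ≠ 1), `gaussInt_normSq_le` (|P|² ≤ c for every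
non-zero member), `gaussInt_card_copies_mul_normSq_le` (n_W·|P|² ≤ c). The E₈ READING (c = 16): t-17 g7 §4.10 (E8-i) «§4.9 (5) holds
verbatim in the unitary basis: Σ_j n_j q_j q_j† = 4·I₆ on ∧²ℂ⁴, q_j = w₁∧w₂ ∈ ½O_K⁶ … LEMMA (M) reads n_W·det G_W ≤ 4 (G_W = Gram of H
on W ∩ L, θ².[B_W] = 2 det G_W)» — for the doubled vectors Q_j := 2q_j ∈ O_K⁶ the identity is `IsFrame 16`, |Q_j|² = 4·det G_W, and
`gaussInt_card_copies_mul_normSq_le` gives n_W·4·det G_W ≤ 16 (the dictionary q_j ↔ W and |q_j|² = det G_W stay TEXT OF RECORD).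
-/

namespace Summit.Ventures.HSemireg.FlatFrame

open Finset

/-! ## §4 The integral instance: `R = ℤ`, trivial star, `N x = x·x` (the integral flat menu, A17-J9; FRAME LEMMA §4.7.5) -/

section IntFrame

variable {ι κ : Type*} [Fintype ι] [DecidableEq ι] [Fintype κ] [DecidableEq κ] {c : ℕ}

/-- An integer with `x·x ≤ 3` has `x·x ≤ 1` (no square is 2 or 3). -/
theorem int_mul_self_le_one_of_le_three {x : ℤ} (h : x * x ≤ 3) : x * x ≤ 1 := by
  by_contra h1
  have h1' : ¬ x.natAbs ≤ (1 : ℤ).natAbs := fun hh => h1 (by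
    have := Int.natAbs_le_iff_mul_self_le.mp hh; linarith)
  have h2 : (2 : ℤ).natAbs ≤ x.natAbs := by
    change 2 ≤ x.natAbs
    change ¬ x.natAbs ≤ 1 at h1'
    omega
  have := Int.natAbs_le_iff_mul_self_le.mp h2
  linarith

omit [Fintype ι] [DecidableEq κ] in
/-- Over `ℤ` the frame identity reads `Σ_j P_j(a)·P_j(b) = c·δ_ab` (the star is trivial): t-17's `Σ_j P(W_j)P(W_j)ᵀ = 4·I₆`. -/
theorem int_isFrame_iff (P : κ → ι → ℤ) :
    IsFrame c P ↔ ∀ a b, ∑ j, P j a * P j b = if a = b then (c : ℤ) else 0 := by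
  simp only [IsFrame, star_trivial]

omit [Fintype ι] in
/-- FRAME LEMMA over ℤ, any constant `c ≠ 1`: every entry `x` of every primitive member has `x·x < c`. -/
theorem int_mul_self_lt {P : κ → ι → ℤ} (hc1 : c ≠ 1) (hP : IsFrame c P) (hprim : ∀ j, Primitive (P j)) (j : κ)
    (a : ι) : P j a * P j a < c :=
  norm_lt_of_primitive (R := ℤ) (fun x => x * x) (fun x => mul_self_nonneg x) (fun x => by simp)
    (fun x hx => mul_self_eq_zero.mp hx)
    (fun x hx => by rcases Int.isUnit_iff.mp hx with h | h <;> simp [h]) hc1 hP (hprim j) a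

omit [Fintype ι] in
/-- **FRAME LEMMA over ℤ (§4.7.5, hand ×2 t-17 g7 ∣ th-1 g39):** in an integral tight frame `Σ_j P_jP_jᵀ = 4·I` with primitive
members, EVERY ENTRY OF EVERY MEMBER IS `0` OR `±1` («all P_ab(W_j) ∈ {0, ±1}»). -/
theorem int_natAbs_le_one {P : κ → ι → ℤ} (hP : IsFrame 4 P) (hprim : ∀ j, Primitive (P j)) (j : κ) (a : ι) :
    (P j a).natAbs ≤ 1 := by
  have h3 : P j a * P j a ≤ 3 := by
    have := int_mul_self_lt (by norm_num) hP hprim j a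
    push_cast at this
    omega
  have h1 : P j a * P j a ≤ 1 * 1 := by have := int_mul_self_le_one_of_le_three h3; linarith
  simpa using Int.natAbs_le_iff_mul_self_le.mpr h1

omit [Fintype ι] in
/-- The same, spelled as membership in `{−1, 0, 1}`. -/
theorem int_mem_of_frame {P : κ → ι → ℤ} (hP : IsFrame 4 P) (hprim : ∀ j, Primitive (P j)) (j : κ) (a : ι) :
    P j a = -1 ∨ P j a = 0 ∨ P j a = 1 := by
  have := int_natAbs_le_one hP hprim j a
  omega

omit [DecidableEq ι] [Fintype κ] [DecidableEq κ] in
/-- For a `{0,±1}`-valued integral vector, `|v|² = Σ_a v(a)² = #supp v` (so «δ_{W_j} = 2·#supp P(W_j)»). -/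
theorem int_normSq_eq_card_support (v : ι → ℤ) (hv : ∀ a, (v a).natAbs ≤ 1) :
    normSq (fun x : ℤ => x * x) v = ((Finset.univ.filter (fun a => v a ≠ 0)).card : ℤ) := by
  simp only [normSq]
  rw [Finset.card_filter, Nat.cast_sum]
  refine Finset.sum_congr rfl (fun a _ => ?_)
  have := hv a
  by_cases h0 : v a = 0
  · simp [h0]
  · rw [if_pos h0]
    have : v a = 1 ∨ v a = -1 := by omega
    rcases this with h | h <;> simp [h]

omit [DecidableEq κ] in
/-- LEMMA (M) over ℤ, any constant: `n_W · |P_j|² ≤ c` and `|P_j|² ≤ c` for every non-zero member (`|P|² = Σ_a P(a)²`;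
primitivity is not needed here). -/
theorem int_card_copies_mul_normSq_le {P : κ → ι → ℤ} (hP : IsFrame c P) {j : κ} (hj : P j ≠ 0) :
    ((copies P (P j)).card : ℤ) * normSq (fun x : ℤ => x * x) (P j) ≤ c ∧ normSq (fun x : ℤ => x * x) (P j) ≤ c :=
  ⟨card_copies_mul_normSq_le (R := ℤ) (fun x => x * x) (fun x => mul_self_nonneg x) (fun x => by simp)
      (fun x hx => mul_self_eq_zero.mp hx) (fun m => by simp) hP hj,
    normSq_le (R := ℤ) (fun x => x * x) (fun x => mul_self_nonneg x) (fun x => by simp)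
      (fun x hx => mul_self_eq_zero.mp hx) (fun m => by simp) hP hj⟩

/-- **LEMMA (M) CONSEQUENCE (a) over ℤ (c = 4):** a member of an integral tight frame with primitive members has SUPPORT OF SIZE ≤ 4
(«#supp P = |P|² ≤ 4, so it is one of the 74 planes of degree ≤ 8 — the 48 support-5 planes (degree 10) of the 122 never occur»,
§4.7.6 (a); th-1 l.7642 (i)). -/
theorem int_card_support_le_four {P : κ → ι → ℤ} (hP : IsFrame 4 P) (hprim : ∀ j, Primitive (P j)) (j : κ) :
    (Finset.univ.filter (fun a => P j a ≠ 0)).card ≤ 4 := by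
  have h4 := (int_card_copies_mul_normSq_le hP (ne_zero_of_primitive (hprim j))).2
  rw [int_normSq_eq_card_support (P j) (int_natAbs_le_one hP hprim j)] at h4
  exact_mod_cast h4

/-- Multiplicity form over ℤ (c = 4): `n_W · #supp ≤ 4` — «|P|² = 4, 3 ⇒ n_W ≤ 1; |P|² = 2 ⇒ n_W ≤ 2; |P|² = 1 ⇒ n_W ≤ 4» (th-1 l.7642
(ii); the attained maxima {8:1, 6:1, 4:2, 2:4} of t-17's multcheck). -/
theorem int_card_copies_mul_support_le_four {P : κ → ι → ℤ} (hP : IsFrame 4 P) (hprim : ∀ j, Primitive (P j)) (j : κ) :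
    (copies P (P j)).card * (Finset.univ.filter (fun a => P j a ≠ 0)).card ≤ 4 := by
  have h4 := (int_card_copies_mul_normSq_le hP (ne_zero_of_primitive (hprim j))).1
  rw [int_normSq_eq_card_support (P j) (int_natAbs_le_one hP hprim j)] at h4
  exact_mod_cast h4

/-- The headline for an INTEGRAL CLASS SOLUTION (c = 4), assembled: every member of an integral tight frame with primitive members is
a `{0,±1}`-vector whose support has size between 1 and 4 («δ_W ∈ {2, 4, 6, 8}») and which occurs at most `4 ∕ #supp` times. -/
theorem int_member_shape {P : κ → ι → ℤ} (hP : IsFrame 4 P) (hprim : ∀ j, Primitive (P j)) (j : κ) :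
    (∀ a, (P j a).natAbs ≤ 1) ∧ 1 ≤ (Finset.univ.filter (fun a => P j a ≠ 0)).card ∧
      (Finset.univ.filter (fun a => P j a ≠ 0)).card ≤ 4 ∧
      (copies P (P j)).card * (Finset.univ.filter (fun a => P j a ≠ 0)).card ≤ 4 := by
  refine ⟨int_natAbs_le_one hP hprim j, ?_, int_card_support_le_four hP hprim j,
    int_card_copies_mul_support_le_four hP hprim j⟩
  obtain ⟨a, ha⟩ : ∃ a, P j a ≠ (0 : ι → ℤ) a := Function.ne_iff.mp (ne_zero_of_primitive (hprim j))
  exact Finset.card_pos.mpr ⟨a, Finset.mem_filter.mpr ⟨Finset.mem_univ a, ha⟩⟩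

/-- NON-VACUITY and SHARPNESS over `ℤ`: the COORDINATE DESIGN `(a, t) ↦ e_a` (`a : Fin 6`, `t : Fin 4`: four copies of each
coordinate vector — the lone Stage-B survivor «four translates of each coordinate plane», §4.7.1 (v), dead only by (α15)) IS an
integral tight frame with constant 4 and primitive members; each member has exactly 4 copies and support of size 1, so the bound
`int_card_copies_mul_support_le_four` (n_W·#supp ≤ 4) is ATTAINED («a coordinate plane (degree 2) at most four times (attained: the
coordinate design)», §4.7.6 (ii)). Kernel `decide`. -/
theorem coordinateDesign_isFrame_and_sharp :
    IsFrame 4 (fun p : Fin 6 × Fin 4 => (Pi.single p.1 (1 : ℤ) : Fin 6 → ℤ)) ∧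
    (∀ p : Fin 6 × Fin 4, Primitive (Pi.single p.1 (1 : ℤ) : Fin 6 → ℤ)) ∧
    (∀ p : Fin 6 × Fin 4,
      (copies (fun q : Fin 6 × Fin 4 => (Pi.single q.1 (1 : ℤ) : Fin 6 → ℤ)) (Pi.single p.1 1)).card = 4 ∧
      (Finset.univ.filter (fun a => (Pi.single p.1 (1 : ℤ) : Fin 6 → ℤ) a ≠ 0)).card = 1) := by
  refine ⟨by unfold IsFrame; decide +kernel, fun p d hd => ?_, by unfold copies; decide +kernel⟩
  have h := hd p.1
  simp only [Pi.single_eq_same] at h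
  exact isUnit_of_dvd_one h

end IntFrame

/-! ## §5 The Gaussian instance: `R = ℤ[i]`, `star` = conjugation, `N = Zsqrtd.norm` (the CM anchor `E_i⁴`, A17-J10 ∕ J11) -/

section GaussFrame

variable {ι κ : Type*} [Fintype ι] [DecidableEq ι] [Fintype κ] {c : ℕ}

omit [Fintype ι] in
/-- FRAME LEMMA over ℤ[i], any constant `c ≠ 1`: every entry of every primitive member has norm `< c`. -/
theorem gaussInt_norm_lt [DecidableEq κ] {P : κ → ι → GaussianInt} (hc1 : c ≠ 1) (hP : IsFrame c P)
    (hprim : ∀ j, Primitive (P j)) (j : κ) (a : ι) : (P j a).norm < c :=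
  norm_lt_of_primitive (R := GaussianInt) Zsqrtd.norm (fun x => Zsqrtd.norm_nonneg (by norm_num) x)
    (fun x => (Zsqrtd.norm_eq_mul_conj x).symm) (fun x hx => (Zsqrtd.norm_eq_zero_iff (by norm_num) x).mp hx)
    (fun x hx => (Zsqrtd.norm_eq_one_iff' (by norm_num) x).mpr hx) hc1 hP (hprim j) a

omit [Fintype ι] in
/-- **FRAME LEMMA over ℤ[i] (§4.9 (5), hand ×2; c = 4):** in a Hermitian tight frame `Σ_j P_jP_j† = 4·I` over the Gaussian integers
with primitive members every entry has NORM ≤ 2, i.e. `N(P_ab) ∈ {0, 1, 2}` («P_ab ∈ {0} ∪ O_K^× ∪ (1+i)·O_K^× for ℤ[i] (norms 0,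
1, 2)»: the abstract bound is `< 4` and `a² + b² = 3` has no solution). -/
theorem gaussInt_norm_le_two [DecidableEq κ] {P : κ → ι → GaussianInt} (hP : IsFrame 4 P)
    (hprim : ∀ j, Primitive (P j)) (j : κ) (a : ι) : (P j a).norm ≤ 2 := by
  have h3 : (P j a).norm ≤ 3 := by
    have := gaussInt_norm_lt (by norm_num) hP hprim j a
    push_cast at this
    omega
  have hdef : (P j a).norm = (P j a).re * (P j a).re + (P j a).im * (P j a).im := by
    rw [Zsqrtd.norm_def]; ring
  by_contra hgt
  have heq : (P j a).norm = 3 := by omega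
  have hre : (P j a).re * (P j a).re ≤ 1 :=
    int_mul_self_le_one_of_le_three (by linarith [mul_self_nonneg (P j a).im])
  have him : (P j a).im * (P j a).im ≤ 1 :=
    int_mul_self_le_one_of_le_three (by linarith [mul_self_nonneg (P j a).re])
  linarith

/-- **LEMMA (M)(i) over ℤ[i], any constant:** every non-zero member (primitivity not needed) has `|P_j|² = Σ_a N(P_j(a)) ≤ c` — at c = 4: θ-degree `δ ≤ 8` at the anchor
`E_i⁴` («the complete CM census IS the δ ≤ 8 census», th-1 l.7642; universes 710 ∣ 618 — machine, not here); at c = 16 (Q_j = 2q_j,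
§4.10 (E8-i)): `|Q|² ≤ 16`, i.e. «det G_W ≤ 4» at the E₈ polarisation. -/
theorem gaussInt_normSq_le {P : κ → ι → GaussianInt} (hP : IsFrame c P) {j : κ} (hj : P j ≠ 0) :
    normSq Zsqrtd.norm (P j) ≤ c :=
  normSq_le (R := GaussianInt) Zsqrtd.norm (fun x => Zsqrtd.norm_nonneg (by norm_num) x)
    (fun x => (Zsqrtd.norm_eq_mul_conj x).symm) (fun x hx => (Zsqrtd.norm_eq_zero_iff (by norm_num) x).mp hx)
    (fun m => Zsqrtd.norm_intCast m) hP hj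

/-- **LEMMA (M)(ii) over ℤ[i], any constant:** `n_W · |P|² ≤ c` for every non-zero member (c = 4 at `E_i⁴`; c = 16 for the doubled E₈ vectors:
«LEMMA (M) reads n_W·det G_W ≤ 4», §4.10 (E8-i)). -/
theorem gaussInt_card_copies_mul_normSq_le {P : κ → ι → GaussianInt} (hP : IsFrame c P) {j : κ}
    (hj : P j ≠ 0) : ((copies P (P j)).card : ℤ) * normSq Zsqrtd.norm (P j) ≤ c :=
  card_copies_mul_normSq_le (R := GaussianInt) Zsqrtd.norm (fun x => Zsqrtd.norm_nonneg (by norm_num) x)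
    (fun x => (Zsqrtd.norm_eq_mul_conj x).symm) (fun x hx => (Zsqrtd.norm_eq_zero_iff (by norm_num) x).mp hx)
    (fun m => Zsqrtd.norm_intCast m) hP hj

end GaussFrame

end Summit.Ventures.HSemireg.FlatFrame
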